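import Summits.QuantumFields.YangMills.Theorems.ParabolicTrajectoryLatticeGapOnTrajectoryStubRateFloor
import HarnessLib

/-!
# Crux `LatticeGapOnTrajectory` (stmt-QuantumFields-10523): the rate floor from an anchor `J` octaves up
# (stub `stub_rateFloorOct`, line `step-scaling-contraction`, served slug `StepScalingSketch`, reshape 4)

Helper file (`--supports stmt-QuantumFields-10523`) proving the registered stub `stub_rateFloorOct` of the
skeleton `Cruxes/LatticeGapOnTrajectory/Lines/step_scaling_contraction.lean` (signature verbatim): the
octave generalisation of the landed `stub_rateFloor` (p129989, the case `J = 0`). For an `M`-adic scheme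
(`a_k = M^{-n_k}`) with `β_k → ∞`, an anchor `μ > 0` at the box of side `2^J · M^{n_k}` (read with the law's
thermal constant) and a uniform volume-doubling law above that box give `TorusGapAt` at the lattice rate
`Δ · a_k` on EVERY torus `S ≥ 2^J M^{n_k}`, eventually in `k`, with `Δ = λ c(law, μ) / (5 · 2^J)`.

The per-coupling core `torusGapAt_of_ladder` (p129989) is already uniform in the anchor side `D`; with
`D = 2^J M^{n_k}` its rate `(λ c / 5) · D⁻¹` is rewritten as `(λ c / 5 / 2^J) · a_k` using `a_k = (M^{n_k})⁻¹`.

References: Lüscher–Weisz–Wolff, Nucl. Phys. B 359 (1991) 221, §2; Glimm–Jaffe, Quantum Physics (1987),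
§19.7.
-/

open scoped ComplexConjugate Topology
open Filter MeasureTheory
open Literature.MathematicalPhysics.QuantumLattice Literature.MathematicalPhysics.QuantumFieldTheory
open Summit.QuantumFields.YangMills.Theses.ParabolicTrajectory
open Summit.QuantumFields.YangMills.Cruxes.LatticeGapOnTrajectory.OrbitKantorovichFiniteSize

noncomputable section

namespace Summit.QuantumFields.YangMills.Cruxes.LatticeGapOnTrajectory.StepScaling

/-- **stub_rateFloorOct** (registered stub of the skeleton `Lines/step_scaling_contraction.lean`,
signature verbatim) — LADDER + RATE FLOOR from an anchor `J` octaves above the unit box (G-blind;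
reshape 4). As `stub_rateFloor` (p129989, the case `J = 0`) with anchor sides `2^J · M^{n_k}`: the ladder
starts `J` octaves up, the rate floor loses the factor `2^{-J}` (`Δ = λ c(law, μ) / (5 · 2^J)`, `c` the
orbit-independent constant of `StepLaw.exists_ladder_const`), and covers every torus `S ≥ 2^J M^{n_k}`,
eventually in `k`. Along the eventual set where the anchor, the law and `0 ≤ β_k` hold this is
`torusGapAt_of_ladder` with `D = 2^J M^{n_k}`; only the conversion `D⁻¹ = a_k / 2^J` changes.
(Lüscher–Weisz–Wolff 1991 §2; Glimm–Jaffe 1987 §19.7.) -/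
theorem stub_rateFloorOct :
    ∀ (G : Type) [Group G] [TopologicalSpace G] [IsTopologicalGroup G] [CompactSpace G]
      [MeasurableSpace G] [BorelSpace G] (r : LatticeRep G) (M : ℕ) (sch : SpeciesScheme (YMSpecies G))
      (n : ℕ → ℕ) (law : StepLaw) (μ : ℝ) (J : ℕ),
        2 ≤ M → (∀ k, sch.a k = ((M : ℝ) ^ n k)⁻¹) → Tendsto sch.β atTop atTop → 0 < μ →
        TunedBoxGap r sch (fun k => 2 ^ J * M ^ n k) law.κ μ →
        UniformStepScaling r sch (fun k => 2 ^ J * M ^ n k) law →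
        ∃ Δ : ℝ, 0 < Δ ∧ RateFloor r sch (fun k => 2 ^ J * M ^ n k) law.κ Δ := by
  intro G _ _ _ _ _ _ r M sch n law μ J hM ha hβ hμ hbox hlaw
  obtain ⟨c, hc, hlad⟩ := law.exists_ladder_const hμ
  refine ⟨law.lam * c / 5 / 2 ^ J, by have := law.lam_pos; positivity, ?_⟩
  have hbox' : ∀ᶠ k in atTop, μ ≤ zeta r.ρ (sch.β k) (2 ^ J * M ^ n k) law.κ := hbox
  have hlaw' : ∀ᶠ k in atTop, ∀ S : ℕ, 2 ^ J * M ^ n k ≤ S →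
      law.Φ (zeta r.ρ (sch.β k) S law.κ) ≤ zeta r.ρ (sch.β k) (2 * S) law.κ ∧
        ∀ S' : ℕ, S ≤ S' → S' ≤ 2 * S →
          law.lam * zeta r.ρ (sch.β k) S law.κ ≤ zeta r.ρ (sch.β k) S' law.κ := hlaw
  have hβ0 : ∀ᶠ k in atTop, 0 ≤ sch.β k := hβ.eventually_ge_atTop 0
  show ∀ᶠ k in atTop, ∀ S : ℕ, 2 ^ J * M ^ n k ≤ S →
    TorusGapAt r.ρ (sch.β k) S (law.lam * c / 5 / 2 ^ J * sch.a k) law.κ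
  filter_upwards [hbox', hlaw', hβ0] with k hboxk hlawk hβk
  intro S hS
  have hD : 1 ≤ 2 ^ J * M ^ n k :=
    Nat.one_le_iff_ne_zero.2 (Nat.mul_ne_zero (pow_ne_zero _ two_ne_zero) (pow_ne_zero _ (by omega)))
  have h := torusGapAt_of_ladder r.continuous hβk law hc hlad hD hboxk hlawk hS
  have e : law.lam * c / 5 * (((2 ^ J * M ^ n k : ℕ) : ℝ))⁻¹ = law.lam * c / 5 / 2 ^ J * sch.a k := by
    rw [ha k]
    push_cast
    ring
  rw [← e]
  exact h

end Summit.QuantumFields.YangMills.Cruxes.LatticeGapOnTrajectory.StepScaling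

end
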